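import Summits.CriticalPhenomena.PercolationContinuityZ3.Theorems.Transplant.KNCellsBoxProdZ2ChainTAR
import Summits.CriticalPhenomena.PercolationContinuityZ3.Theorems.Transplant.KNCellsBoxProdZ2InnerRun
import HarnessLib

/-!
# Design (D), `advRoute_of_contact` part 4: the INNER TUBE RUN of a face-step contact — the rooted straight-run data `innerTAD` in the inner
# tube `B_X(c, L_A)` about the contact's cube centre `c`, its regions inside the face-step region `B(w₀,R) × farA`, its far face inside
# `B(w₀,Rt) × C.M(x+du)` (deepness `B(c, L_A) ⊆ B(w₀, Rt)`) and off the contact's kit cube, and the transfer `innerRoute_lt`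
# (`lt_real_of_advRChain` for `innerTAD`): the pieces of p3-g2's `hroute` (BoxProdZ2ConcFace) that are planar / chain bookkeeping

builds on p205010 (kernel theorem, internal audit signed; external expert review pending) — nothing in this file uses p205010.
Lane `prim-bschramm`, seat `prim-bschramm-p2` (advRoute_of_contact); helper file (`--supports stmt-CriticalPhenomena-4575`).

What stays a hypothesis (p3-g2's providers, native form): the inner kit clauses (`hkits_tube₂` at centre `c`, rooms `TubeAdvData.roomR`), the
inner rim excess (`real_rim_le_of_wired_source`), the first hop `hsrc` into `B₀ ⊆ B(c, L_A) × start row` (input link + wiring), the subbox /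
support facts of the wired-restricted law `W'` on the rooted regions, the chain property (stmt's `chain_edge_tube_UP` at `(δ_A ↦ δ₂²)`), and the
domination `hdom : P_{W'}(⋃ t ∈ Ft, o ↔ t) ≤ P_{Wt}(linkIn Qt S Ft)`.
* `innerTAD`; `innerTAD_Rim_subset`, **`innerTAD_stepDR_subset`** (regions ⊆ `B(w₀,R) × farA`), **`innerTAD_coreT_subset`** (far face ⊆
  `B(w₀,Rt) × C.M(x+du)`), `innerTAD_coreT_disjoint`, **`innerRoute_lt`**.
[cite: KozmaNitzan2024, §4 Lemma 10 Step IV (pp. 19–21), Lemma 11 (pp. 22–23), p. 30 (Step III)]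
-/

noncomputable section

open MeasureTheory ProbabilityTheory
open scoped ENNReal Classical

namespace Summit.CriticalPhenomena.PercolationContinuityZ3.Theorems

namespace Transplant

namespace BoxProdZ2

open Literature.Probability.Percolation Literature.Probability.LatticeModels SimpleGraph
open Literature.Probability.Percolation.KozmaNitzan
open Literature.Probability.Percolation.KozmaNitzan.Cells (sgOf sgOf_sign)
open Literature.Barriers.CriticalPhenomena (mem_graphBall_self)
open KNLevels ChainPlanar

variable {W : Type} [DecidableEq W] (X : SimpleGraph W) [X.LocallyFinite]

/-- **The inner straight run of a face-step contact** with cube centre `c`: tube `B_X(c, L_A)`, start row (`q = 0`) of half-width `q'` at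
signed level `ca` / transverse offset `cb` about `C.cen x`, advance `s₁`, `nA` steps, rooted regions, rim parts `(B(c,L_A) \ B(c, L_A - L'_A)) × regionR_k`,
source `o` (a point of the wired kit prism), support `Sfin`. [cite: KozmaNitzan2024, §4 Lemma 11 (p. 22), p. 30] -/
def innerTAD (c : W) (L_A L'_A : ℕ) (C : PCells) (x : Site 2) (du : MDir) (ca cb q' s₁ : ℤ) (R' ℓ₀ nA Rlev N j₀ j₁ : ℕ)
    (o : W × Site 2) (Sfin : Finset (W × Site 2)) : TubeAdvData W where
  π := ballFin X c L_A
  q := 0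
  q' := q'
  s₁ := s₁
  ρ := innerρ q' s₁ R' nA
  R' := R'
  ℓ₀ := ℓ₀
  nA := nA
  ax := du.1
  sg := sgOf du
  c := innerCtr C x du ca cb
  Rlev := Rlev
  N := N
  j₀ := j₀
  j₁ := j₁
  root := o
  Sfin := Sfin
  Rim := fun k => (ballFin X c L_A \ ballFin X c (L_A - L'_A)) ×ˢ Adv.regionR 0 s₁ (innerρ q' s₁ R' nA) R' du.1 (sgOf du) (innerCtr C x du ca cb) k

section Planar

variable {c : W} {L_A L'_A : ℕ} {C : PCells} {x : Site 2} {du : MDir} {ca cb q' s₁ : ℤ} {R' ℓ₀ nA Rlev N j₀ j₁ : ℕ}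
  {o : W × Site 2} {Sfin : Finset (W × Site 2)}

/-- The rim parts lie in the rooted regions. [folklore] -/
theorem innerTAD_Rim_subset (k : ℕ) :
    (innerTAD X c L_A L'_A C x du ca cb q' s₁ R' ℓ₀ nA Rlev N j₀ j₁ o Sfin).Rim k ⊆
      (innerTAD X c L_A L'_A C x du ca cb q' s₁ R' ℓ₀ nA Rlev N j₀ j₁ o Sfin).stepDR k :=
  Finset.product_subset_product_left Finset.sdiff_subset

/-- **The inner regions lie in the face-step region `B(w₀, R) × farA x du j`** (`k ≤ nA`; `B(c, L_A) ⊆ B(w₀, R)`).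
[cite: KozmaNitzan2024, §4 p. 30 (Step III), Lemma 11 (p. 22: Ω)] -/
theorem innerTAD_stepDR_subset {j : ℕ} (h : InnerRunOK C j s₁ R' ℓ₀ nA ca cb q') {w₀ : W} {R : ℕ} (hπ : ballFin X c L_A ⊆ ballFin X w₀ R)
    {k : ℕ} (hk : k ≤ nA) :
    (innerTAD X c L_A L'_A C x du ca cb q' s₁ R' ℓ₀ nA Rlev N j₀ j₁ o Sfin).stepDR k ⊆ ballFin X w₀ R ×ˢ C.farA x du j :=
  Finset.product_subset_product hπ (innerRun_regionR_subset_farA h hk)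

/-- **The far face of the inner run lies in `B(w₀, Rt) × C.M (x + du)`** under deepness `B(c, L_A) ⊆ B(w₀, Rt)`.
[cite: KozmaNitzan2024, §4 Lemma 10 Step IV (p. 20), p. 30] -/
theorem innerTAD_coreT_subset {j : ℕ} (h : InnerRunOK C j s₁ R' ℓ₀ nA ca cb q') {w₀ : W} {Rt : ℕ} (hdeep : ballFin X c L_A ⊆ ballFin X w₀ Rt) :
    (innerTAD X c L_A L'_A C x du ca cb q' s₁ R' ℓ₀ nA Rlev N j₀ j₁ o Sfin).coreT nA ⊆ ballFin X w₀ Rt ×ˢ C.M (x + stepVec du) :=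
  Finset.product_subset_product hdeep (innerRun_last_subset_M h)

/-- **The far face misses the contact's kit cube** as soon as the cube's planar shadow misses `C.M (x + du)`. [folklore] -/
theorem innerTAD_coreT_disjoint {j : ℕ} (h : InnerRunOK C j s₁ R' ℓ₀ nA ca cb q') {Kc : Finset (W × Site 2)}
    (hKc : ∀ z ∈ Kc, z.2 ∉ C.M (x + stepVec du)) :
    Disjoint ((innerTAD X c L_A L'_A C x du ca cb q' s₁ R' ℓ₀ nA Rlev N j₀ j₁ o Sfin).coreT nA) Kc := by
  rw [Finset.disjoint_left]
  intro z hz hzK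
  exact hKc z hzK (innerRun_last_subset_M h (Finset.mem_product.1 hz).2)

end Planar

/-- **THE INNER ROUTE TRANSFERRED** (`lt_real_of_advRChain` for `innerTAD`): with the planar admissibility `InnerRunOK`, the per-step facts of the
law `W'` on the rooted regions, the kit clauses, the rim excess `≤ η ≤ δ/2`, the chain property of length `nA + 1` at `(δ ↦ ε'')`, the first
hop into `B₀ ⊆ B(c, L_A) × start row` and the domination of `P_{W'}(o ↔ far face)` by `μA`, we get `1 - ε'' < μA`.
[cite: KozmaNitzan2024, §4 Lemma 11 (pp. 22–23), Lemma 12 (pp. 23–25), p. 20 (Step IV)] -/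
theorem innerRoute_lt {c : W} {L_A L'_A : ℕ} {C : PCells} {x : Site 2} {du : MDir} {ca cb q' s₁ : ℤ} {R' ℓ₀ nA Rlev N j₀ j₁ : ℕ}
    {o : W × Site 2} {Sfin : Finset (W × Site 2)} {j : ℕ} (h : InnerRunOK C j s₁ R' ℓ₀ nA ca cb q')
    (hRl : Rlev + 1 ≤ R') (hj : j₁ ≤ Rlev)
    {p : unitInterval} {W' : Sym2 (W × Site 2) → unitInterval} {μA : ℝ} {Δ' : ℕ} {δ ε'' η : ℝ}
    (hchain : ∀ (Wg : Sym2 (W × Site 2) → unitInterval) (s : Fin (nA + 1) → TStep (tubeGraph X (ballFin X c L_A)))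
      (T' : Fin (nA + 1) → Finset (W × Site 2)) (η : ℝ),
      (∀ i, (s i).L.o = (s 0).L.o) →
      (∀ i : Fin nA, T' (Fin.castSucc i) ⊆ (s i.succ).L.X 0) →
      (∀ i, T' i ⊆ (s i).T) →
      (∀ i, (s i).KitsAt Wg p Δ' δ) →
      η ≤ δ / 2 →
      (∀ i, (prodBernoulli Wg).real (⋃ t ∈ (s i).T \ T' i, openConn (s 0).L.o t) ≤ η) →
      1 - δ < (prodBernoulli Wg).real (s 0).L.reachB →
        1 - ε'' < (prodBernoulli Wg).real (⋃ t ∈ T' (Fin.last nA), openConn (s 0).L.o t))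
    (hsub : ∀ k ≤ nA, IsSubbox (tubeGraph X (ballFin X c L_A)) W' p
      ((innerTAD X c L_A L'_A C x du ca cb q' s₁ R' ℓ₀ nA Rlev N j₀ j₁ o Sfin).stepDR k))
    (hfin : FinSupp W' Sfin)
    (hDS : ∀ k ≤ nA, (innerTAD X c L_A L'_A C x du ca cb q' s₁ R' ℓ₀ nA Rlev N j₀ j₁ o Sfin).stepDR k ⊆ Sfin)
    (ho : ∀ k ≤ nA, o ∉ (innerTAD X c L_A L'_A C x du ca cb q' s₁ R' ℓ₀ nA Rlev N j₀ j₁ o Sfin).stepDR k) (hoS : o ∈ Sfin)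
    (hcount : 1 / (1 - (p : ℝ)) ^ (Δ' * N) ≤ δ * ((Finset.Icc j₀ j₁).card : ℝ))
    (hkits : ∀ k ≤ nA, ∀ j' ∈ Finset.Icc j₀ j₁, ∃ (σ : SData (W × Site 2)) (Sz : Finset (W × Site 2)),
      SHyp (tubeLData X (ballFin X c L_A) ((innerTAD X c L_A L'_A C x du ca cb q' s₁ R' ℓ₀ nA Rlev N j₀ j₁ o Sfin).alo k)
        ((innerTAD X c L_A L'_A C x du ca cb q' s₁ R' ℓ₀ nA Rlev N j₀ j₁ o Sfin).ahi k) o Sfin) j' σ ∧ σ.N ≤ N ∧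
      (1 - (p : ℝ) ^ σ.sB) ^ σ.k ≤ δ ∧
      Sz ⊆ (tubeLData X (ballFin X c L_A) ((innerTAD X c L_A L'_A C x du ca cb q' s₁ R' ℓ₀ nA Rlev N j₀ j₁ o Sfin).alo k)
        ((innerTAD X c L_A L'_A C x du ca cb q' s₁ R' ℓ₀ nA Rlev N j₀ j₁ o Sfin).ahi k) o Sfin).X j' ∧
      Sz ⊆ (innerTAD X c L_A L'_A C x du ca cb q' s₁ R' ℓ₀ nA Rlev N j₀ j₁ o Sfin).stepDR k ∧
      (∀ y ∈ σ.K, ∀ e ∈ σ.seed y, e ∉ wireSet (↑Sz : Set (W × Site 2))) ∧ (∀ y ∈ σ.K, σ.face y ⊆ Sz) ∧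
      (∀ y ∈ σ.K, 1 - 3 * δ ≤ (prodBernoulli W').real {ω | ∃ u ∈ σ.face y,
        1 - δ < (prodBernoulli (pinW W' (wireSet (↑Sz : Set (W × Site 2))) ω)).real
          (⋃ z ∈ (innerTAD X c L_A L'_A C x du ca cb q' s₁ R' ℓ₀ nA Rlev N j₀ j₁ o Sfin).coreE k,
            openConnIn (↑((innerTAD X c L_A L'_A C x du ca cb q' s₁ R' ℓ₀ nA Rlev N j₀ j₁ o Sfin).stepDR k) : Set (W × Site 2)) u z)}))
    (hη : η ≤ δ / 2)
    (hexc : ∀ k ≤ nA, (prodBernoulli W').real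
      (⋃ z ∈ (innerTAD X c L_A L'_A C x du ca cb q' s₁ R' ℓ₀ nA Rlev N j₀ j₁ o Sfin).Rim k, openConn o z) ≤ η)
    {B₀ : Finset (W × Site 2)}
    (hB₀ : B₀ ⊆ ballFin X c L_A ×ˢ Adv.core 0 q' s₁ R' du.1 (sgOf du) (innerCtr C x du ca cb) 0)
    (hsrc : 1 - δ < (prodBernoulli W').real (⋃ z ∈ B₀, openConn o z))
    (hdom : (prodBernoulli W').real
      (⋃ z ∈ (innerTAD X c L_A L'_A C x du ca cb q' s₁ R' ℓ₀ nA Rlev N j₀ j₁ o Sfin).coreT nA, openConn o z) ≤ μA) :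
    1 - ε'' < μA := by
  set P := innerTAD X c L_A L'_A C x du ca cb q' s₁ R' ℓ₀ nA Rlev N j₀ j₁ o Sfin with hP
  have hsg : P.sg = 1 ∨ P.sg = -1 := sgOf_sign du
  have hOK : Adv.AdvOK P.q P.q' P.s₁ P.ρ P.R' P.ℓ₀ P.nA := innerRun_advOK h
  have hπ : P.π.Nonempty := ⟨c, (mem_ballFin X).2 (mem_graphBall_self X c _)⟩
  refine TubeAdvData.lt_real_of_advRChain X hsg hOK hRl (innerTAD_Rim_subset X) hπ hchain hsub hfin hDS ho hoS hj hcount hkits hη hexc ?_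
    hsrc subset_rfl hdom
  -- the first-hop box lies in the first level `π_A × core 0`
  rw [TubeAdvData.stepL_X_zero _ _ hsg]
  exact hB₀

end BoxProdZ2

end Transplant

end Summit.CriticalPhenomena.PercolationContinuityZ3.Theorems

end
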